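import Summits.BirchSwinnertonDyer.BirchSwinnertonDyer.Theorems.PrintCf2RubinValueTwoLinePinExponentPin
import HarnessLib

/-!
# M-LINE-PIN, part 8b: THE EULER-EXPONENT PIN WITH A GENERAL ANALYTIC EXPONENT `d` —
# `(c₁ · E^c) = (c₂ · E^d) ⟹ c = d` in `𝒪⟦T⟧`; the `v`-line gives `corank_{ℤ_p}(coker of slot-1 control) = d` and the crux's clause

Cell `bsd-print-cf2`, width seat `bsd-line-cf2c-w8` g4 (prover-bsd-line-cf2c-w8-g4-0), planner g19's named piece M-LINE-PIN (crux child
stmt-BirchSwinnertonDyer-24086 `MainConjClauseAtSplitTwoQuad`). Sequel of part 8 (`…LinePinExponentPin`, exponent `d = 1`): the analytic Euler factor at `v̄`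
may be ABSENT — `d = 0` when `θ_K` is ramified at `v̄` (the even-but-ramified members of the class, e.g. `θ` cutting out `K(√2) ⊂ K̃_∞`, where two
Frobenius lifts `τ, τ·i` act by `+1` and `−1` and the algebraic defect exponent is forced to `0`) — or present (`d = 1`, `θ_K` unramified at `v̄`).
The same coefficient comparison in `𝒪⟦T⟧` (any domain `𝒪`, `e₀` a non-unit) gives `(c₁ · (T+e₀)^c) = (c₂ · (T+e₀)^d) ⟹ c = d`, so the ⊗ℚ-form (Q)
restricted to the `v`-line pins BOTH the `p`-power and `c = d`: the cokernel of the slot-1 control has `ℤ_p`-corank EXACTLY the analytic exponent.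
`--supports stmt-BirchSwinnertonDyer-24086 --as helper`, Theses-free. HONEST FRAMING: algebra + assembly; displayed inputs exactly as in part 8 ((Q) `hQ`,
(M) `hM` + `hD₁`, (A) `hA` now with `^ d`, S3n′ `hfin`, `[Finite g.ker]`, even class `hI`). No summit statement is proved by this seat; BSD is not proved
by any of this. THEOREMS ONLY (no definition, no named fact, no `sorry`).

* `eq_zero_of_associated_C_mul_X_add_C_pow` — `(c₁ (T+e₀)^m) = (c₂)` ⟹ `m = 0`; `eq_of_associated_C_mul_X_add_C_pow_pow` — `(c₁ E^c) = (c₂ E^d) ⟹ c = d`.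
* `eq_and_span_eq_of_span_C_mul_eq` — abstract pin: `(k₁ f) = (k₂ g)`, `(f) = (E)^c (G₁)`, `(g) = (E)^d (G₁)`, `G₁ ≠ 0` ⟹ `c = d ∧ (f) = (g) ∧ f ≠ 0`.
* `map_constantCoeff_charIdeal_ne_bot_of_powForm_pow`, `eq_and_map_charIdeal_eq_span_of_powForm` — socket currency with `(A)` to the power `d`.
* `zpCorank_eq_and_map_charIdeal_eq_span_of_powForm` — with part 7: `IsTorsion Λ₂ D₂.X ∧ corank_{ℤ_p} C = d ∧ a = b ∧ (ch_{Λ₂} D₂.X).map (map (map J)) = (G₂)`.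
presearch: as part 8 (Washington §13.2 shape; folklore coefficient algebra) — none in print needed. beyond-print theorem: no.

References: [Washington1997] §13.2; [GreenbergVatsal2000] §2 Prop. (2.4); [deShalit1987] II.4.12; [Mueller2020MCSplitTwo] Thm. 1.3.
-/

noncomputable section

open scoped Classical Pointwise AddSubgroup NumberField

-- the summit namespace `Summit.BirchSwinnertonDyer.BirchSwinnertonDyer` repeats the problem name by design (D-0017)
set_option linter.dupNamespace false
set_option autoImplicit false

open NumberField IsDedekindDomain Field Literature.NumberTheory.GaloisRepresentations
  Literature.NumberTheory.EllipticCurves Literature.NumberTheory.EllipticCurves.Module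
  Literature.NumberTheory.EllipticCurves.IwasawaAlgebra Literature.NumberTheory.EllipticCurves.GreenbergSelmer
  Literature.NumberTheory.EllipticCurves.GreenbergVatsal2000 Literature.NumberTheory.EllipticCurves.KellerYin2024
  Literature.NumberTheory.EllipticCurves.IwasawaDual
open Summit.BirchSwinnertonDyer.BirchSwinnertonDyer.Theorems.PrintCf2

namespace Summit.BirchSwinnertonDyer.BirchSwinnertonDyer.Theorems.PrintCf2.LinePin

/-! ## GENERAL EXPONENT `d`: `(c₁ · E^c) = (c₂ · E^d) ⟹ c = d` — the analytic Euler factor at `v̄` may be ABSENT (`d = 0`, `θ_K` ramified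
at `v̄`: the even-but-ramified members, e.g. `θ` cutting out `K(√2) ⊂ K̃_∞`) or present (`d = 1`); the `v`-line pins `corank_{ℤ_p}(coker) = d` either way -/

section GeneralAlgebra

variable {𝒪 : Type*} [CommRing 𝒪] [IsDomain 𝒪]

/-- `𝒪` a domain, `e₀` a non-unit, `c₂ ≠ 0`: `(c₁ · (T + e₀)^m) = (c₂)` as ideals of `𝒪⟦T⟧` ⟹ `m = 0` (compare the `T⁰, T^m` coefficients of
`c₂ w = c₁ (T+e₀)^m`: `w₀ = w_m e₀^m`, a non-unit constant term of the unit `w`). [folklore] -/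
theorem eq_zero_of_associated_C_mul_X_add_C_pow {e₀ c₁ c₂ : 𝒪} (he₀ : ¬ IsUnit e₀) (hc₂ : c₂ ≠ 0) {m : ℕ}
    (h : Associated (PowerSeries.C c₁ * (PowerSeries.X + PowerSeries.C e₀) ^ m) (PowerSeries.C c₂)) : m = 0 := by
  rcases m with _ | n
  · rfl
  · exfalso
    obtain ⟨w, hw⟩ := h.symm
    have hw0 : IsUnit (PowerSeries.coeff 0 (↑w : PowerSeries 𝒪)) := by
      rw [PowerSeries.coeff_zero_eq_constantCoeff_apply]
      exact PowerSeries.isUnit_constantCoeff _ w.isUnit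
    have hN := congrArg (PowerSeries.coeff (n + 1)) hw
    have h0 := congrArg (PowerSeries.coeff 0) hw
    rw [PowerSeries.coeff_C_mul, PowerSeries.coeff_C_mul, coeff_X_add_C_pow, Nat.sub_self, pow_zero, one_mul, Nat.choose_self,
      Nat.cast_one, mul_one] at hN
    rw [PowerSeries.coeff_C_mul, PowerSeries.coeff_C_mul, coeff_X_add_C_pow, Nat.sub_zero, Nat.choose_zero_right, Nat.cast_one,
      mul_one] at h0
    have hw0N : PowerSeries.coeff 0 (↑w : PowerSeries 𝒪) = PowerSeries.coeff (n + 1) (↑w : PowerSeries 𝒪) * e₀ ^ (n + 1) :=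
      mul_left_cancel₀ hc₂ (by rw [h0, ← mul_assoc, hN])
    rw [hw0N] at hw0
    exact he₀ ((isUnit_pow_iff (Nat.succ_ne_zero n)).mp (isUnit_of_mul_isUnit_right hw0))

/-- **THE EULER-EXPONENT PIN, GENERAL FORM.** `𝒪` a domain, `e₀` a non-unit, `c₁, c₂ ≠ 0`: `(c₁ · (T+e₀)^c) = (c₂ · (T+e₀)^d)` as ideals of
`𝒪⟦T⟧` ⟹ `c = d` (cancel the common power of `T + e₀`, then `eq_zero_of_associated_C_mul_X_add_C_pow`). [folklore] -/
theorem eq_of_associated_C_mul_X_add_C_pow_pow {e₀ c₁ c₂ : 𝒪} (he₀ : ¬ IsUnit e₀) (hc₁ : c₁ ≠ 0) (hc₂ : c₂ ≠ 0) {c d : ℕ}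
    (h : Associated (PowerSeries.C c₁ * (PowerSeries.X + PowerSeries.C e₀) ^ c)
      (PowerSeries.C c₂ * (PowerSeries.X + PowerSeries.C e₀) ^ d)) : c = d := by
  have hE0 := X_add_C_ne_zero (𝒪 := 𝒪) e₀
  rcases le_total c d with hcd | hdc
  · obtain ⟨k, rfl⟩ := Nat.exists_eq_add_of_le hcd
    have h' : Associated ((PowerSeries.X + PowerSeries.C e₀) ^ c * PowerSeries.C c₁)
        ((PowerSeries.X + PowerSeries.C e₀) ^ c * (PowerSeries.C c₂ * (PowerSeries.X + PowerSeries.C e₀) ^ k)) := by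
      have e1 : (PowerSeries.X + PowerSeries.C e₀) ^ c * PowerSeries.C c₁ = PowerSeries.C c₁ * (PowerSeries.X + PowerSeries.C e₀) ^ c :=
        mul_comm _ _
      have e2 : (PowerSeries.X + PowerSeries.C e₀) ^ c * (PowerSeries.C c₂ * (PowerSeries.X + PowerSeries.C e₀) ^ k) =
          PowerSeries.C c₂ * (PowerSeries.X + PowerSeries.C e₀) ^ (c + k) := by
        rw [pow_add]; ring
      rw [e1, e2]; exact h
    have hk : k = 0 :=
      eq_zero_of_associated_C_mul_X_add_C_pow he₀ hc₁ (Associated.of_mul_left h' (Associated.refl _) (pow_ne_zero c hE0)).symm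
    rw [hk, add_zero]
  · obtain ⟨k, rfl⟩ := Nat.exists_eq_add_of_le hdc
    have h' : Associated ((PowerSeries.X + PowerSeries.C e₀) ^ d * (PowerSeries.C c₁ * (PowerSeries.X + PowerSeries.C e₀) ^ k))
        ((PowerSeries.X + PowerSeries.C e₀) ^ d * PowerSeries.C c₂) := by
      have e1 : (PowerSeries.X + PowerSeries.C e₀) ^ d * (PowerSeries.C c₁ * (PowerSeries.X + PowerSeries.C e₀) ^ k) =
          PowerSeries.C c₁ * (PowerSeries.X + PowerSeries.C e₀) ^ (d + k) := by
        rw [pow_add]; ring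
      have e2 : (PowerSeries.X + PowerSeries.C e₀) ^ d * PowerSeries.C c₂ = PowerSeries.C c₂ * (PowerSeries.X + PowerSeries.C e₀) ^ d :=
        mul_comm _ _
      rw [e1, e2]; exact h
    have hk : k = 0 :=
      eq_zero_of_associated_C_mul_X_add_C_pow he₀ hc₂ (Associated.of_mul_left h' (Associated.refl _) (pow_ne_zero d hE0))
    rw [hk, add_zero]

/-- **THE ABSTRACT LINE PIN, GENERAL EXPONENTS.** In `𝒪⟦T⟧` (`𝒪` a domain), `E = T + e₀` (`e₀` a non-unit), non-zero constants `k₁, k₂`: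
`(k₁ f) = (k₂ g)`, `(f) = (E)^c · (G₁)`, `(g) = (E)^d · (G₁)`, `G₁ ≠ 0` ⟹ `c = d`, `(f) = (g)`, `f ≠ 0`. [folklore] -/
theorem eq_and_span_eq_of_span_C_mul_eq {e₀ k₁ k₂ : 𝒪} (he₀ : ¬ IsUnit e₀) (hk₁ : k₁ ≠ 0) (hk₂ : k₂ ≠ 0)
    {f g G₁ : PowerSeries 𝒪} (hG₁ : G₁ ≠ 0) {c d : ℕ}
    (hk : Ideal.span ({PowerSeries.C k₁ * f} : Set (PowerSeries 𝒪)) = Ideal.span {PowerSeries.C k₂ * g})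
    (hf : Ideal.span ({f} : Set (PowerSeries 𝒪)) = Ideal.span {PowerSeries.X + PowerSeries.C e₀} ^ c * Ideal.span {G₁})
    (hg : Ideal.span ({g} : Set (PowerSeries 𝒪)) = Ideal.span {PowerSeries.X + PowerSeries.C e₀} ^ d * Ideal.span {G₁}) :
    c = d ∧ Ideal.span ({f} : Set (PowerSeries 𝒪)) = Ideal.span {g} ∧ f ≠ 0 := by
  rw [Ideal.span_singleton_pow, Ideal.span_singleton_mul_span_singleton] at hf hg
  have hfa : Associated f ((PowerSeries.X + PowerSeries.C e₀) ^ c * G₁) := Ideal.span_singleton_eq_span_singleton.mp hf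
  have hga : Associated g ((PowerSeries.X + PowerSeries.C e₀) ^ d * G₁) := Ideal.span_singleton_eq_span_singleton.mp hg
  have hka : Associated (PowerSeries.C k₁ * f) (PowerSeries.C k₂ * g) := Ideal.span_singleton_eq_span_singleton.mp hk
  have h1 : Associated (PowerSeries.C k₁ * (PowerSeries.X + PowerSeries.C e₀) ^ c * G₁)
      (PowerSeries.C k₂ * (PowerSeries.X + PowerSeries.C e₀) ^ d * G₁) := by
    rw [mul_assoc, mul_assoc]
    exact ((hfa.mul_left (PowerSeries.C k₁)).symm.trans hka).trans (hga.mul_left (PowerSeries.C k₂))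
  have h2 : Associated (PowerSeries.C k₁ * (PowerSeries.X + PowerSeries.C e₀) ^ c)
      (PowerSeries.C k₂ * (PowerSeries.X + PowerSeries.C e₀) ^ d) :=
    Associated.of_mul_right h1 (Associated.refl G₁) hG₁
  have hcd : c = d := eq_of_associated_C_mul_X_add_C_pow_pow he₀ hk₁ hk₂ h2
  subst hcd
  refine ⟨rfl, by rw [hf, hg], ?_⟩
  rw [hfa.ne_zero_iff]
  exact mul_ne_zero (pow_ne_zero c (X_add_C_ne_zero e₀)) hG₁

end GeneralAlgebra

section GeneralSocket

universe u

variable {K : Type u} [Field K] [NumberField K] {p : ℕ} [Fact p.Prime] {κ₁ κ₂ : ZpExtension K p}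
  {M : Type u} [AddCommGroup M] [DistribMulAction (absoluteGaloisGroup K) M] [TopologicalSpace M] [DiscreteTopology M]
  {vbar : HeightOneSpectrum (𝓞 K)} {γ₁ γ₂ : absoluteGaloisGroup K}

/-- **`(ch_{Λ₂} D.X)(T₁,0) ≠ 0` FOR FREE, general exponent**: from (Q), `(G₂(T₁,0)) = ((1+T) − u)^d · (G₁)` and `G₁ ≠ 0`.
[cite: Washington1997, §13.2 (shape only)] -/
theorem map_constantCoeff_charIdeal_ne_bot_of_powForm_pow (D : DualData₂ κ₁ κ₂ M vbar γ₁ γ₂)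
    (J : ℤ_[p] →+* PadicComplexInt p) (G₂ : PowerSeries (PowerSeries (PadicComplexInt p)))
    (F : IwasawaAlgebra₂ p) (hF : charIdeal (IwasawaAlgebra₂ p) D.X = Ideal.span {F})
    {a b : ℕ} (hQ : Ideal.span ({((p : ℕ) : PowerSeries (PowerSeries (PadicComplexInt p))) ^ a *
        PowerSeries.map (PowerSeries.map J) F} : Set (PowerSeries (PowerSeries (PadicComplexInt p)))) =
      Ideal.span {((p : ℕ) : PowerSeries (PowerSeries (PadicComplexInt p))) ^ b * G₂})
    (u : ℤ) (G₁ : PowerSeries (PadicComplexInt p)) (hG₁ : G₁ ≠ 0) {d : ℕ}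
    (hA : Ideal.span ({PowerSeries.map (PowerSeries.constantCoeff (R := PadicComplexInt p)) G₂} : Set (PowerSeries (PadicComplexInt p))) =
      Ideal.span {((1 : PowerSeries (PadicComplexInt p)) + PowerSeries.X) - (u : PowerSeries (PadicComplexInt p))} ^ d *
        Ideal.span {G₁}) :
    (charIdeal (IwasawaAlgebra₂ p) D.X).map (PowerSeries.map (PowerSeries.constantCoeff (R := ℤ_[p]))) ≠ ⊥ := by
  have hp0 : ((p : ℕ) : PadicComplexInt p) ≠ 0 := natCast_prime_padicComplexInt_ne_zero (p := p)
  have hk := span_C_pow_mul_line_eq_of_powForm J G₂ F hQ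
  rw [one_add_X_sub_intCast_eq, Ideal.span_singleton_pow, Ideal.span_singleton_mul_span_singleton] at hA
  have hga : Associated (PowerSeries.map (PowerSeries.constantCoeff (R := PadicComplexInt p)) G₂)
      ((PowerSeries.X + PowerSeries.C ((1 : PadicComplexInt p) - (u : PadicComplexInt p))) ^ d * G₁) :=
    Ideal.span_singleton_eq_span_singleton.mp hA
  have hg0 : PowerSeries.map (PowerSeries.constantCoeff (R := PadicComplexInt p)) G₂ ≠ 0 :=
    hga.ne_zero_iff.mpr (mul_ne_zero (pow_ne_zero d (X_add_C_ne_zero _)) hG₁)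
  have hka := Ideal.span_singleton_eq_span_singleton.mp hk
  have hCb : PowerSeries.C (((p : ℕ) : PadicComplexInt p) ^ b) ≠ 0 := fun h ↦
    pow_ne_zero b hp0 (PowerSeries.C_injective (h.trans (map_zero _).symm))
  have hf0 : PowerSeries.map J (PowerSeries.map (PowerSeries.constantCoeff (R := ℤ_[p])) F) ≠ 0 :=
    right_ne_zero_of_mul (hka.ne_zero_iff.mpr (mul_ne_zero hCb hg0))
  rw [hF, map_span_singleton, Ne, Ideal.span_singleton_eq_bot]
  intro h0
  exact hf0 (by rw [h0, map_zero])

/-- **THE LINE PIN WITH FREE EXPONENTS ON BOTH SIDES (socket currency).** As `eq_one_and_map_charIdeal_eq_span_of_powForm`, with the analytic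
Euler factor at `v̄` to the power `d` ((A): `(G₂(T₁,0)) = ((1+T) − u)^d · (G₁)`; `d = 1` when `θ_K` is unramified at `v̄`, `d = 0` when the factor is
absent) and the algebraic `v̄`-defect to the power `c`: **`c = d`, `a = b`, `(ch_{Λ₂} D.X).map (map (map J)) = (G₂)`.**
[cite: Washington1997, §13.2 (shape only)] [cite: deShalit1987, II.4.12] [cite: Mueller2020MCSplitTwo, Thm. 1.3] -/
theorem eq_and_map_charIdeal_eq_span_of_powForm (D : DualData₂ κ₁ κ₂ M vbar γ₁ γ₂)
    (J : ℤ_[p] →+* PadicComplexInt p) (G₂ : PowerSeries (PowerSeries (PadicComplexInt p)))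
    (F : IwasawaAlgebra₂ p) (hF : charIdeal (IwasawaAlgebra₂ p) D.X = Ideal.span {F})
    {a b : ℕ} (hQ : Ideal.span ({((p : ℕ) : PowerSeries (PowerSeries (PadicComplexInt p))) ^ a *
        PowerSeries.map (PowerSeries.map J) F} : Set (PowerSeries (PowerSeries (PadicComplexInt p)))) =
      Ideal.span {((p : ℕ) : PowerSeries (PowerSeries (PadicComplexInt p))) ^ b * G₂})
    {u : ℤ} (hpu : (p : ℤ) ∣ u - 1) {c : ℕ} {I₁ : Ideal (IwasawaAlgebra p)}
    (hC : (charIdeal (IwasawaAlgebra₂ p) D.X).map (PowerSeries.map (PowerSeries.constantCoeff (R := ℤ_[p]))) =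
      Ideal.span {((1 : IwasawaAlgebra p) + PowerSeries.X) - (u : IwasawaAlgebra p)} ^ c * I₁)
    (G₁ : PowerSeries (PadicComplexInt p)) (hG₁ : G₁ ≠ 0) (hM : I₁.map (PowerSeries.map J) = Ideal.span {G₁}) {d : ℕ}
    (hA : Ideal.span ({PowerSeries.map (PowerSeries.constantCoeff (R := PadicComplexInt p)) G₂} : Set (PowerSeries (PadicComplexInt p))) =
      Ideal.span {((1 : PowerSeries (PadicComplexInt p)) + PowerSeries.X) - (u : PowerSeries (PadicComplexInt p))} ^ d *
        Ideal.span {G₁}) :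
    c = d ∧ a = b ∧ (charIdeal (IwasawaAlgebra₂ p) D.X).map (PowerSeries.map (PowerSeries.map J)) = Ideal.span {G₂} := by
  have hp0 : ((p : ℕ) : PadicComplexInt p) ≠ 0 := natCast_prime_padicComplexInt_ne_zero (p := p)
  have hk := span_C_pow_mul_line_eq_of_powForm J G₂ F hQ
  have hf : Ideal.span ({PowerSeries.map J (PowerSeries.map (PowerSeries.constantCoeff (R := ℤ_[p])) F)} :
        Set (PowerSeries (PadicComplexInt p))) =
      Ideal.span {PowerSeries.X + PowerSeries.C ((1 : PadicComplexInt p) - (u : PadicComplexInt p))} ^ c * Ideal.span {G₁} := by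
    have h := congrArg (Ideal.map (PowerSeries.map J)) hC
    rw [hF, map_span_singleton, map_span_singleton, Ideal.map_mul, Ideal.map_pow, map_span_singleton, hM, map_sub, map_add,
      map_one, PowerSeries.map_X, map_intCast, one_add_X_sub_intCast_eq] at h
    exact h
  rw [one_add_X_sub_intCast_eq] at hA
  obtain ⟨hcd, hline, hf0⟩ := eq_and_span_eq_of_span_C_mul_eq (not_isUnit_one_sub_intCast_padicComplexInt hpu)
    (pow_ne_zero a hp0) (pow_ne_zero b hp0) hG₁ hk hf hA
  obtain ⟨hab, h⟩ := map_charIdeal_eq_span_of_powForm_of_firstLine D J G₂ F hF hQ hline hf0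
  exact ⟨hcd, hab, h⟩

end GeneralSocket

section GeneralJunction

variable {K : Type} [Field K] [NumberField K] {p : ℕ} [Fact p.Prime] {κ κ₂ : ZpExtension K p}
  {M : Type} [AddCommGroup M] [DistribMulAction (absoluteGaloisGroup K) M] [TopologicalSpace M] [DiscreteTopology M]
  {𝔮 : HeightOneSpectrum (𝓞 K)} {γ γ₂ : absoluteGaloisGroup K}
  {g : unrSelmer κ M 𝔮 ∅ →+ unrSelmer₂ κ κ₂ M 𝔮}
  (hg : ∀ t : unrSelmer κ M 𝔮 ∅,
    ((g t : unrSelmer₂ κ κ₂ M 𝔮) : subgroupH1 (ZpExtension.pairKer κ κ₂) M) =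
      resOfLe M (ZpExtension.pairKer_le_left κ κ₂) (t : subgroupH1 κ.kerSubgroup M))
  {D₂ : DualData₂ κ κ₂ M 𝔮 γ γ₂} {D₁ : DatumDualData κ γ M (Castella2018.AcSelmer.bdpData M p 𝔮) ∅}
  {φ : D₂.X →ₛₗ[PowerSeries.map (PowerSeries.constantCoeff (R := ℤ_[p]))] D₁.X}
  (hφ : ∀ (x : D₂.X) (t : unrSelmer κ M 𝔮 ∅), D₁.toDual (φ x) t = D₂.toDual x (g t))
include hg hφ

/-- **M-LINE-PIN ASSEMBLED ON THE FIRST SLOT, GENERAL ANALYTIC EXPONENT `d`.** As `zpCorank_eq_one_and_map_charIdeal_eq_span_of_powForm` with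
(A) `(G₂(T₁,0)) = ((1+T) − u)^d · (G₁)`: then `D₂.X` is `Λ₂`-torsion, **`corank_{ℤ_p} C = d`** (the `ℤ_p`-corank of the cokernel of the slot-1 control
EQUALS the analytic Euler exponent at `v̄`), `a = b`, and **`(ch_{Λ₂} D₂.X).map (map (map J)) = (G₂)`**. [cite: GreenbergVatsal2000, §2 Prop. (2.4) (p. 22)]
[cite: GreenbergLNM1716, §4 Lemma 4.2] [cite: Washington1997, §13.2] [cite: deShalit1987, II.4.12] [cite: Mueller2020MCSplitTwo, Thm. 1.3] -/
theorem zpCorank_eq_and_map_charIdeal_eq_span_of_powForm [Module.Finite (IwasawaAlgebra₂ p) D₂.X] [Finite g.ker]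
    (hγ : ZpExtension.IsTopGeneratorPair κ κ₂ γ γ₂)
    (hcont : ∀ m : M, Continuous fun σ : absoluteGaloisGroup K ↦ σ • m) (hprim : ∀ m : M, ∃ k : ℕ, p ^ k • m = 0)
    (hκ₂ : κ₂.IsUnramifiedOutside 𝔮) (h𝔮 : ((p : ℕ) : 𝓞 K) ∈ 𝔮.asIdeal)
    (hI : ∀ y : absoluteGaloisGroup K, y ∈ ZpExtension.pairKer κ κ₂ → y ∈ inertia 𝔮 → ∀ m : M, y • m = m)
    {τ : absoluteGaloisGroup K} (hτ : τ ∈ decomp 𝔮) (hκτ : κ τ = κ γ) {u : ℤ} (hu : ∀ m : M, τ • m = u • m)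
    (hpu : (p : ℤ) ∣ u - 1)
    {C : Type*} [AddCommGroup C] (πC : ↥(endInvariants (conjSel₂ κ κ₂ M 𝔮 γ₂ - 1)) →+ C) (hsurj : Function.Surjective πC)
    (hker : ∀ s : ↥(endInvariants (conjSel₂ κ κ₂ M 𝔮 γ₂ - 1)), πC s = 0 ↔ (s : unrSelmer₂ κ κ₂ M 𝔮) ∈ g.range)
    (hD₁ : Module.IsTorsion (IwasawaAlgebra p) D₁.X)
    (hfin : ∀ N : Submodule (IwasawaAlgebra₂ p) D₂.X, Module.IsPseudoNull (IwasawaAlgebra₂ p) N → Finite N)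
    (J : ℤ_[p] →+* PadicComplexInt p) (G₂ : PowerSeries (PowerSeries (PadicComplexInt p)))
    (F : IwasawaAlgebra₂ p) (hF : charIdeal (IwasawaAlgebra₂ p) D₂.X = Ideal.span {F})
    {a b : ℕ} (hQ : Ideal.span ({((p : ℕ) : PowerSeries (PowerSeries (PadicComplexInt p))) ^ a *
        PowerSeries.map (PowerSeries.map J) F} : Set (PowerSeries (PowerSeries (PadicComplexInt p)))) =
      Ideal.span {((p : ℕ) : PowerSeries (PowerSeries (PadicComplexInt p))) ^ b * G₂})
    (G₁ : PowerSeries (PadicComplexInt p)) (hG₁ : G₁ ≠ 0)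
    (hM : (charIdeal (IwasawaAlgebra p) D₁.X).map (PowerSeries.map J) = Ideal.span {G₁}) {d : ℕ}
    (hA : Ideal.span ({PowerSeries.map (PowerSeries.constantCoeff (R := PadicComplexInt p)) G₂} : Set (PowerSeries (PadicComplexInt p))) =
      Ideal.span {((1 : PowerSeries (PadicComplexInt p)) + PowerSeries.X) - (u : PowerSeries (PadicComplexInt p))} ^ d *
        Ideal.span {G₁}) :
    Module.IsTorsion (IwasawaAlgebra₂ p) D₂.X ∧ zpCorank C p = d ∧ a = b ∧
      (charIdeal (IwasawaAlgebra₂ p) D₂.X).map (PowerSeries.map (PowerSeries.map J)) = Ideal.span {G₂} := by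
  have hne := map_constantCoeff_charIdeal_ne_bot_of_powForm_pow D₂ J G₂ F hF hQ u G₁ hG₁ hA
  obtain ⟨htors, -, hC⟩ := map_charIdeal_eq_span_pow_zpCorank_mul hg hφ hγ hcont hprim hκ₂ h𝔮 hI hτ hκτ hu hpu πC hsurj hker
    hD₁ hne hfin
  obtain ⟨hcd, hab, h⟩ := eq_and_map_charIdeal_eq_span_of_powForm D₂ J G₂ F hF hQ hpu hC G₁ hG₁ hM hA
  exact ⟨htors, hcd, hab, h⟩

end GeneralJunction

end Summit.BirchSwinnertonDyer.BirchSwinnertonDyer.Theorems.PrintCf2.LinePin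

end
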